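import Literature.RingTheory.Flat.IdealClosureGenericFibre
import Mathlib.RingTheory.TensorProduct.Quotient
import Mathlib.RingTheory.Flat.Stability
import HarnessLib

/-!
# The flat closure of the generic fibre commutes with base change of the base ring (EGA IV₂ 2.8.5 + flat base change; Stacks 081I)

Topic `RingTheory/Flat`; namespace `Literature.RingTheory.Flat`; sequel of ★ `IdealClosureGenericFibre` (G2a: saturated ∕ flat ideals `I ≤ A` over
`R` are the closures `J ∩ A` of their generic fibres `J ≤ B`, uniquely — `comap_map_eq_self_of_forall_smul_mem_imp`, `map_comap_eq_self`,
`eq_of_forall_smul_mem_imp_of_map_eq`, `flat_quotient_comap_of_isBezout`).  THEOREMS ONLY (no definition, no instance, no notation, no named fact, no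
`sorry`); Mathlib + ★ G2a only.  Cell `pub/hodgecm-mathlib` (D-0151 ∕ D-0183 floor 0), P6 «MOD programme», sub-line P6c «DICT» organ **(o-c2g′)**
(desk F0P6c-plan 14:26:00Z: «closure commutes with base change `V → V′` of valuation rings»; consumers: (o-c2f) closure clause of a `V`-point's
kernel, DICT's `sp y L` independence of the field of definition `L ⊂ L′`, P6b (b4)); the companion (o-c2g) «a flat closed subscheme is the closure of
its generic fibre; two flat closed subschemes with the same generic fibre are equal» is ★ G2a `eq_of_flat_quotient_of_map_eq` ∕ G2c
`eq_comap_includeRight_of_flat_of_map_eq` and is only CITED here.  Generic, count-neutral capital `--supports stmt-HodgeConjecture-24832`.  HONEST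
LABEL: HC_CM is proved only modulo the printed citations until rung 0 closes; this file pays no letter.

SETTING.  `V → V′` commutative rings (`[Algebra V V′]`), `A` a commutative `V`-algebra with base change `A′ = V′ ⊗_V A` (Mathlib `TensorProduct`,
`includeRight : A → A′`), `B` «the generic fibre of `A`» = any localization of `A` at the image of `V⁰` and `B′` that of `A′` at the image of `V′⁰`
(★ G2a currency `[IsLocalization (algebraMapSubmonoid _ R⁰) _]`; e.g. `B = K ⊗_V A`, `B′ = K′ ⊗_{V′} A′` by ★ G2c `isLocalization_includeRight`),
and `g : B → B′` a ring map compatible with `includeRight` (it exists as soon as `V⁰` goes into `V′⁰`, §3).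

* §1 `flat_quotient_map_includeRight` — if `A ⧸ I` is `V`-flat then `A′ ⧸ I·A′ ≅ V′ ⊗_V (A ⧸ I)` (Mathlib `Algebra.TensorProduct.tensorQuotientEquiv`)
  is `V′`-flat; hence `I·A′` is SATURATED for `V′⁰` (`forall_smul_mem_imp_map_includeRight`) and is the closure of its own generic fibre
  (`comap_map_map_includeRight_eq`).
* §2 **`comap_map_eq_map_comap_includeRight`** — THE HEAD: for `J ≤ B` whose closure `J ∩ A` has `V`-FLAT quotient, the closure in `A′` of the base-changed
  generic ideal `J·B′` is the base change `(J ∩ A)·A′` of the closure («closure commutes with base change»): both are `V′⁰`-saturated with the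
  same generic fibre (★ G2a uniqueness); hypothesis-free over a Bézout domain ∕ valuation ring `V` (`comap_map_eq_map_comap_includeRight_of_isBezout`, ★
  `flat_quotient_comap_of_isBezout`).
* §3 `exists_ringHom_comp_algebraMap_eq_includeRight` — the compatible `g : B → B′` exists whenever `algebraMap V V′` maps `V⁰` into `V′⁰` (e.g. an injection of
  domains, `exists_ringHom_comp_algebraMap_eq_includeRight_of_injective`): `IsLocalization.lift`.

## References
* [EGAIV2] A. Grothendieck, J. Dieudonné, *ÉGA* IV₂, Publ. Math. IHÉS 24 (1965), Prop. 2.8.5 (and 2.8.1: the closure of the generic fibre is flat).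
* [StacksProject] The Stacks Project, Tag 081I (scheme-theoretic closure commutes with flat base change), Tag 0815, Tag 0AUW.
* [GortzWedhorn2020] U. Görtz, T. Wedhorn, *Algebraic Geometry I*, 2nd ed. (2020), Prop. 14.14, Lemma 14.6 (flat base change).
-/

set_option autoImplicit false

namespace Literature.RingTheory.Flat

open scoped nonZeroDivisors TensorProduct

section BaseChange

variable {V V' A : Type*} [CommRing V] [CommRing V'] [Algebra V V'] [CommRing A] [Algebra V A]

/-! ## §1 The base change of an ideal with flat quotient has flat quotient, hence is saturated -/

/-- **`A′ ⧸ I·A′ ≅ V′ ⊗_V (A ⧸ I)` is `V′`-flat when `A ⧸ I` is `V`-flat** (`A′ = V′ ⊗_V A`; Mathlib `Algebra.TensorProduct.tensorQuotientEquiv` and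
flat base change). [cite: StacksProject, Tag 081I] [cite: GortzWedhorn2020, Lemma 14.6] -/
theorem flat_quotient_map_includeRight (I : Ideal A) [Module.Flat V (A ⧸ I)] :
    Module.Flat V' ((V' ⊗[V] A) ⧸ I.map (Algebra.TensorProduct.includeRight : A →ₐ[V] V' ⊗[V] A)) :=
  Module.Flat.of_linearEquiv (Algebra.TensorProduct.tensorQuotientEquiv (R := V) V' A V' I).symm.toLinearEquiv

/-- Hence the base-changed ideal `I·A′` is SATURATED with respect to `V′⁰`. [cite: EGAIV2, Prop. 2.8.5] [cite: StacksProject, Tag 081I] -/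
theorem forall_smul_mem_imp_map_includeRight (I : Ideal A) [Module.Flat V (A ⧸ I)] :
    ∀ r : V', r ∈ V'⁰ → ∀ x : V' ⊗[V] A, r • x ∈ I.map (Algebra.TensorProduct.includeRight : A →ₐ[V] V' ⊗[V] A) →
      x ∈ I.map (Algebra.TensorProduct.includeRight : A →ₐ[V] V' ⊗[V] A) :=
  haveI := flat_quotient_map_includeRight (V := V) (V' := V') I
  forall_smul_mem_imp_of_flat (R := V') (I.map (Algebra.TensorProduct.includeRight : A →ₐ[V] V' ⊗[V] A))

/-- … and is therefore the closure of its own generic fibre: `((I·A′)·B′) ∩ A′ = I·A′` for any generic fibre `B′` of `A′` over `V′`.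
[cite: EGAIV2, Prop. 2.8.5] -/
theorem comap_map_map_includeRight_eq (I : Ideal A) [Module.Flat V (A ⧸ I)] {B' : Type*} [CommRing B'] [Algebra (V' ⊗[V] A) B']
    [IsLocalization (Algebra.algebraMapSubmonoid (V' ⊗[V] A) V'⁰) B'] :
    ((I.map (Algebra.TensorProduct.includeRight : A →ₐ[V] V' ⊗[V] A)).map (algebraMap (V' ⊗[V] A) B')).comap
        (algebraMap (V' ⊗[V] A) B') = I.map (Algebra.TensorProduct.includeRight : A →ₐ[V] V' ⊗[V] A) :=
  comap_map_eq_self_of_forall_smul_mem_imp (R := V') _ (forall_smul_mem_imp_map_includeRight (V := V) (V' := V') I)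

/-! ## §2 The closure of the generic fibre commutes with base change -/

variable {B B' : Type*} [CommRing B] [Algebra A B] [IsLocalization (Algebra.algebraMapSubmonoid A V⁰) B]
  [CommRing B'] [Algebra (V' ⊗[V] A) B'] [IsLocalization (Algebra.algebraMapSubmonoid (V' ⊗[V] A) V'⁰) B']
  (g : B →+* B') (hg : g.comp (algebraMap A B) =
    (algebraMap (V' ⊗[V] A) B').comp (Algebra.TensorProduct.includeRight : A →ₐ[V] V' ⊗[V] A))

omit [IsLocalization (Algebra.algebraMapSubmonoid (V' ⊗[V] A) V'⁰) B'] in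
include hg in
/-- The generic fibre of the base change `(J ∩ A)·A′` is the base change `J·B′` of the generic ideal. [cite: EGAIV2, Prop. 2.8.5] -/
theorem map_map_comap_includeRight_eq (J : Ideal B) :
    ((J.comap (algebraMap A B)).map (Algebra.TensorProduct.includeRight : A →ₐ[V] V' ⊗[V] A)).map (algebraMap (V' ⊗[V] A) B') =
      J.map g := by
  rw [← Ideal.map_coe (Algebra.TensorProduct.includeRight : A →ₐ[V] V' ⊗[V] A), Ideal.map_map, ← hg, ← Ideal.map_map,
    map_comap_eq_self (R := V)]

include hg in
/-- **THE CLOSURE OF THE GENERIC FIBRE COMMUTES WITH BASE CHANGE** (EGA IV₂ 2.8.5 with flat base change).  `V → V′`, `A′ = V′ ⊗_V A`, generic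
fibres `B`, `B′` with `g : B → B′` over `includeRight`; for an ideal `J ≤ B` whose closure `J ∩ A` has `V`-FLAT quotient, the closure in `A′` of
`J·B′` IS `(J ∩ A)·A′`: both are `V′⁰`-saturated ideals of `A′` (§1; ★ G2a `forall_smul_mem_imp_comap`) with generic fibre `J·B′`
(`map_map_comap_includeRight_eq`; ★ `map_comap_eq_self`), hence equal (★ `eq_of_forall_smul_mem_imp_of_map_eq`).
[cite: EGAIV2, Prop. 2.8.5] [cite: StacksProject, Tag 081I] -/
theorem comap_map_eq_map_comap_includeRight (J : Ideal B) [Module.Flat V (A ⧸ J.comap (algebraMap A B))] :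
    (J.map g).comap (algebraMap (V' ⊗[V] A) B') =
      (J.comap (algebraMap A B)).map (Algebra.TensorProduct.includeRight : A →ₐ[V] V' ⊗[V] A) := by
  refine eq_of_forall_smul_mem_imp_of_map_eq (R := V') (B := B') (forall_smul_mem_imp_comap (R := V') _)
    (forall_smul_mem_imp_map_includeRight (V := V) (V' := V') _) ?_
  rw [map_comap_eq_self (R := V'), map_map_comap_includeRight_eq g hg]

include hg in
/-- **Over a Bézout domain (e.g. a VALUATION RING) `V` the flatness hypothesis is automatic** (★ G2a `flat_quotient_comap_of_isBezout`): the closure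
of the generic fibre commutes with ANY base change `V → V′` of the base ring. [cite: EGAIV2, Prop. 2.8.5] [cite: StacksProject, Tag 0AUW] -/
theorem comap_map_eq_map_comap_includeRight_of_isBezout [IsBezout V] [IsDomain V] (J : Ideal B) :
    (J.map g).comap (algebraMap (V' ⊗[V] A) B') =
      (J.comap (algebraMap A B)).map (Algebra.TensorProduct.includeRight : A →ₐ[V] V' ⊗[V] A) :=
  haveI := flat_quotient_comap_of_isBezout (R := V) (A := A) (B := B) J
  comap_map_eq_map_comap_includeRight g hg J

/-! ## §3 The comparison map of generic fibres -/

omit [IsLocalization (Algebra.algebraMapSubmonoid A V⁰) B] in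
/-- For `r ∈ V⁰` mapping into `V′⁰`, the image of `algebraMap V A r` in a generic fibre `B′` of `A′` is a unit. [cite: StacksProject, Tag 081I] -/
theorem isUnit_algebraMap_includeRight_algebraMap (hV : V⁰ ≤ (V'⁰).comap (algebraMap V V')) (r : V) (hr : r ∈ V⁰) :
    IsUnit (algebraMap (V' ⊗[V] A) B' (Algebra.TensorProduct.includeRight (R := V) (A := V') (algebraMap V A r))) := by
  have h1 : (Algebra.TensorProduct.includeRight (R := V) (A := V') (algebraMap V A r) : V' ⊗[V] A) =
      algebraMap V' (V' ⊗[V] A) (algebraMap V V' r) := by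
    rw [AlgHom.commutes, IsScalarTower.algebraMap_apply V V' (V' ⊗[V] A)]
  rw [h1]
  exact IsLocalization.map_units B'
    ⟨_, Algebra.mem_algebraMapSubmonoid_of_mem ⟨algebraMap V V' r, Submonoid.mem_comap.mp (hV hr)⟩⟩

/-- **The comparison map `g : B → B′` of generic fibres exists** as soon as `algebraMap V V′` sends `V⁰` into `V′⁰` (`IsLocalization.lift`).
[cite: StacksProject, Tag 081I] -/
theorem exists_ringHom_comp_algebraMap_eq_includeRight (hV : V⁰ ≤ (V'⁰).comap (algebraMap V V')) :
    ∃ g : B →+* B', g.comp (algebraMap A B) =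
      (algebraMap (V' ⊗[V] A) B').comp (Algebra.TensorProduct.includeRight : A →ₐ[V] V' ⊗[V] A) := by
  have hu : ∀ y : Algebra.algebraMapSubmonoid A V⁰,
      IsUnit (((algebraMap (V' ⊗[V] A) B').comp (Algebra.TensorProduct.includeRight : A →ₐ[V] V' ⊗[V] A) : A →+* B') y) := by
    rintro ⟨y, hy⟩
    obtain ⟨r, hr, rfl⟩ := Submonoid.mem_map.mp hy
    exact isUnit_algebraMap_includeRight_algebraMap (B' := B') hV r hr
  exact ⟨IsLocalization.lift (M := Algebra.algebraMapSubmonoid A V⁰) hu, IsLocalization.lift_comp hu⟩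

/-- In particular for an INJECTIVE map to a DOMAIN `V′` (e.g. an extension of valuation rings). [cite: StacksProject, Tag 081I] -/
theorem exists_ringHom_comp_algebraMap_eq_includeRight_of_injective [IsDomain V] [IsDomain V'] (hinj : Function.Injective (algebraMap V V')) :
    ∃ g : B →+* B', g.comp (algebraMap A B) =
      (algebraMap (V' ⊗[V] A) B').comp (Algebra.TensorProduct.includeRight : A →ₐ[V] V' ⊗[V] A) := by
  refine exists_ringHom_comp_algebraMap_eq_includeRight (fun r hr => ?_)
  rw [Submonoid.mem_comap]
  exact mem_nonZeroDivisors_of_ne_zero fun h => nonZeroDivisors.ne_zero hr (hinj (by rw [h, map_zero]))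

end BaseChange

end Literature.RingTheory.Flat
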